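import Literature.NumberTheory.GaloisRepresentations.CubicEisensteinRamificationBreakProofs
import HarnessLib

/-!
# The tame character `θ₀ : G₀ → κ(𝔓)ˣ` with kernel `G₁` for a prime of a finite Galois extension
# of the fraction field of a Dedekind domain (Serre, *Local Fields*, IV §2 Prop. 7, Cor. 1 — the
# GLOBAL Dedekind setting)

`Proofs` file (theorems only: no definition, no named fact, debt 0), topic
`NumberTheory/GaloisRepresentations`.  The tree's `TameInertiaCyclicProofs.lean` proves the same
statement for a finite Galois subextension `E/F` of `F̄` with `F` a non-archimedean LOCAL field
(`isCyclic_map_inertia_of_forall_mem_ramificationSubgroup_one`, through the discrete valuation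
ring `O_E`).  Here the base is any Dedekind domain `R` with fraction field `K`, `L/K` is finite
Galois, `S = integralClosure R L`, `𝔓` a non-zero prime of `S`, `G = Gal(L/K)` acting on `S`,
`G₀ = I(𝔓)` its inertia group and `G₁` the first ramification group
(`Ideal.ramificationSubgroup`, `RamificationFiltration.lean`):

* `exists_tameCharacter` — there is a homomorphism `θ₀ : G₀ → (S ⧸ 𝔓)ˣ` with
  `θ₀ σ = 1 ↔ σ ∈ G₁`: `θ₀(σ) = σ(ϖ)/ϖ mod 𝔓` for a fixed `ϖ ∈ 𝔓 ∖ 𝔓²`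
  (`𝔓 = (ϖ) + 𝔓²`, `exists_eq_pow_mul_add_of_mem_pow`; the kernel is `G₁` by the UNIFORMIZER
  CRITERION `mem_ramificationSubgroup_iff_of_mem_inertia`, Serre IV §1 Lemma 1 / §2 Prop. 5, whose
  residue-class hypothesis is Serre I §7 Prop. 21 c), `exists_inertia_fixed_sub_mem`);
* `exists_generator_inertia_mod_ramificationSubgroup_one` — hence, when the residue ring `S ⧸ 𝔓`
  is finite, **`G₀/G₁` is cyclic**: some `g ∈ G₀` has `G₀ = ⋃ₖ gᵏ G₁`;
* `exists_card_inertia_eq_mul_dvd` — and **`#G₀ = #G₁ · m` with `m ∣ #(S ⧸ 𝔓) − 1`** (so `m` is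
  prime to the residue characteristic), together with the normality `conj_mem_ramificationSubgroup_one_of_mem_inertia`.

Use (cell `bsd-rank1-residual`, team n1011, row T-b9 'tame tower at `3`', §5 of the generic
layer): with `L = ℚ(E[3])` and `𝔓 ∣ 3`, `G₁` is a `3`-group
(`isPGroup_three_ramificationSubgroup_one`) and `m ∣ 3^f − 1`, so an inertia image in
`Aut(E[3]) ≅ GL₂(𝔽₃)` of order divisible by `3` has a NORMAL Sylow `3`-subgroup with CYCLIC
quotient — which forces its order to divide `6`.

## References

* [SerreLocalFields1979] J.-P. Serre, *Local Fields*, GTM 67 (1979), Ch. IV §1 Lemma 1, §2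
  Prop. 5, Prop. 7 and Cor. 1 ("`G₀/G₁` is cyclic of order prime to `p`"); Ch. I §7 Prop. 21 c).
-/

noncomputable section

open scoped Pointwise

namespace Literature.NumberTheory.GaloisRepresentations

variable (R : Type*) {K L : Type*} [CommRing R] [IsDedekindDomain R] [Field K] [Field L]
  [Algebra R K] [IsFractionRing R K] [Algebra R L] [Algebra K L] [IsScalarTower R K L]
  [FiniteDimensional K L] [IsGalois K L]
  (𝔓 : Ideal (integralClosure R L)) [𝔓.IsMaximal]

variable {R}

/-! ### `𝔓 = (ϖ) + 𝔓²`: the coefficient of `σ(ϖ)` along `ϖ` -/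

include K in
/-- In the Dedekind domain `S = integralClosure R L`: for `ϖ ∈ 𝔓 ∖ 𝔓²` and any `x`,
`ϖ x ∈ 𝔓² ↔ x ∈ 𝔓` (`v_𝔓(ϖ x) = 1 + v_𝔓(x)`). [folklore] -/
private theorem mul_mem_sq_iff (h𝔓 : 𝔓 ≠ ⊥) {ϖ : integralClosure R L} (hϖ : ϖ ∈ 𝔓) (hϖ2 : ϖ ∉ 𝔓 ^ 2)
    (x : integralClosure R L) : ϖ * x ∈ 𝔓 ^ 2 ↔ x ∈ 𝔓 := by
  haveI : IsDedekindDomain (integralClosure R L) := integralClosure.isDedekindDomain R K L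
  constructor
  · intro h
    have h1 : ord 𝔓 ϖ = 1 := ord_eq_one 𝔓 hϖ hϖ2
    have h2 : (2 : ℕ∞) ≤ ord 𝔓 ϖ + ord 𝔓 x := by
      rw [← ord_mul 𝔓 h𝔓]; exact (mem_pow_iff_le_ord 𝔓).mp h
    rw [h1] at h2
    have hx : (1 : ℕ∞) ≤ ord 𝔓 x := by
      rcases eq_or_ne (ord 𝔓 x) ⊤ with htop | hne
      · rw [htop]; exact le_top
      · lift ord 𝔓 x to ℕ using hne with n hn
        have h2' : (2 : ℕ) ≤ 1 + n := by exact_mod_cast h2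
        exact_mod_cast (by omega : 1 ≤ n)
    have := (mem_pow_iff_le_ord 𝔓 (b := x) (n := 1)).mpr (by exact_mod_cast hx)
    rwa [pow_one] at this
  · intro hx
    rw [pow_two]
    exact Ideal.mul_mem_mul hϖ hx

include K in
/-- For `σ` in the inertia group of `𝔓` and `ϖ ∈ 𝔓 ∖ 𝔓²` there is `d ∈ S` with
`σ(ϖ) ≡ ϖ d (mod 𝔓²)` (`𝔓 = (ϖ) + 𝔓²`, `exists_eq_pow_mul_add_of_mem_pow` with `k = 1`).
[cite: SerreLocalFields1979, Ch. IV §2 Prop. 7 (case i = 0)] -/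
theorem exists_smul_sub_mul_mem_sq (h𝔓 : 𝔓 ≠ ⊥) {ϖ : integralClosure R L} (hϖ : ϖ ∈ 𝔓)
    (hϖ2 : ϖ ∉ 𝔓 ^ 2) {σ : L ≃ₐ[K] L} (hσ : σ ∈ 𝔓.inertia (L ≃ₐ[K] L)) :
    ∃ d : integralClosure R L, σ • ϖ - ϖ * d ∈ 𝔓 ^ 2 := by
  haveI : IsDedekindDomain (integralClosure R L) := integralClosure.isDedekindDomain R K L
  have hσP : σ • 𝔓 = 𝔓 := 𝔓.inertia_le_stabilizer hσ
  have hmem : σ • ϖ ∈ 𝔓 ^ 1 := by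
    rw [pow_one]
    have := smul_mem_pow_of_smul_eq 𝔓 hσP (m := 1) (x := ϖ) (by rwa [pow_one])
    rwa [pow_one] at this
  obtain ⟨d, c', hc', heq⟩ := exists_eq_pow_mul_add_of_mem_pow 𝔓 h𝔓 hϖ hϖ2 hmem
  refine ⟨d, ?_⟩
  rw [heq, pow_one, add_sub_cancel_left]
  exact hc'

include K in
/-- The coefficient `d` of `exists_smul_sub_mul_mem_sq` is NOT in `𝔓` (`σ(ϖ) ∉ 𝔓²` because
`σ⁻¹` preserves `𝔓²`). [folklore] -/
private theorem not_mem_of_smul_sub_mul_mem_sq (h𝔓 : 𝔓 ≠ ⊥) {ϖ : integralClosure R L} (hϖ : ϖ ∈ 𝔓)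
    (hϖ2 : ϖ ∉ 𝔓 ^ 2) {σ : L ≃ₐ[K] L} (hσ : σ ∈ 𝔓.inertia (L ≃ₐ[K] L))
    {d : integralClosure R L} (hd : σ • ϖ - ϖ * d ∈ 𝔓 ^ 2) : d ∉ 𝔓 := by
  haveI : IsDedekindDomain (integralClosure R L) := integralClosure.isDedekindDomain R K L
  intro hdP
  have hσP : σ • 𝔓 = 𝔓 := 𝔓.inertia_le_stabilizer hσ
  have h1 : ϖ * d ∈ 𝔓 ^ 2 := (mul_mem_sq_iff (K := K) 𝔓 h𝔓 hϖ hϖ2 d).mpr hdP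
  have h2 : σ • ϖ ∈ 𝔓 ^ 2 := by
    have := Submodule.add_mem _ hd h1
    rwa [sub_add_cancel] at this
  exact hϖ2 ((smul_mem_pow_iff_of_smul_eq 𝔓 hσP).mp h2)

include K in
/-- **Uniqueness of the coefficient mod `𝔓`**: if `σ(ϖ) ≡ ϖ d ≡ ϖ d' (mod 𝔓²)` then
`d ≡ d' (mod 𝔓)`. [folklore] -/
private theorem sub_mem_of_smul_sub_mul_mem_sq (h𝔓 : 𝔓 ≠ ⊥) {ϖ : integralClosure R L} (hϖ : ϖ ∈ 𝔓)
    (hϖ2 : ϖ ∉ 𝔓 ^ 2) {y d d' : integralClosure R L}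
    (hd : y - ϖ * d ∈ 𝔓 ^ 2) (hd' : y - ϖ * d' ∈ 𝔓 ^ 2) : d - d' ∈ 𝔓 := by
  have h : ϖ * (d - d') ∈ 𝔓 ^ 2 := by
    have := Submodule.sub_mem _ hd' hd
    have e : y - ϖ * d' - (y - ϖ * d) = ϖ * (d - d') := by ring
    rwa [e] at this
  exact (mul_mem_sq_iff (K := K) 𝔓 h𝔓 hϖ hϖ2 _).mp h

omit [IsDedekindDomain R] [IsFractionRing R K] [FiniteDimensional K L] [IsGalois K L]
  [𝔓.IsMaximal] in
/-- **Multiplicativity**: if `σ(ϖ) ≡ ϖ d_σ` and `τ(ϖ) ≡ ϖ d_τ (mod 𝔓²)` with `σ` in the inertia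
group, then `(στ)(ϖ) ≡ ϖ d_σ d_τ (mod 𝔓²)` — `σ` acts trivially on `d_τ` mod `𝔓` and preserves
`𝔓²`. [cite: SerreLocalFields1979, Ch. IV §2 Prop. 7 (θ₀ is a homomorphism)] -/
theorem mul_smul_sub_mul_mul_mem_sq {ϖ : integralClosure R L} (hϖ : ϖ ∈ 𝔓)
    {σ τ : L ≃ₐ[K] L} (hσ : σ ∈ 𝔓.inertia (L ≃ₐ[K] L))
    {dσ dτ : integralClosure R L} (hdσ : σ • ϖ - ϖ * dσ ∈ 𝔓 ^ 2)
    (hdτ : τ • ϖ - ϖ * dτ ∈ 𝔓 ^ 2) : (σ * τ) • ϖ - ϖ * (dσ * dτ) ∈ 𝔓 ^ 2 := by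
  have hσP : σ • 𝔓 = 𝔓 := 𝔓.inertia_le_stabilizer hσ
  -- `σ • (τ ϖ - ϖ dτ) ∈ 𝔓²`
  have h1 : σ • (τ • ϖ - ϖ * dτ) ∈ 𝔓 ^ 2 := smul_mem_pow_of_smul_eq 𝔓 hσP hdτ
  -- `σ dτ - dτ ∈ 𝔓`, so `ϖ dσ (σ dτ - dτ) ∈ 𝔓²`
  have h2 : σ • dτ - dτ ∈ 𝔓 := hσ dτ
  have h3 : ϖ * dσ * (σ • dτ - dτ) ∈ 𝔓 ^ 2 := by
    rw [pow_two, mul_assoc]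
    exact Ideal.mul_mem_mul hϖ (Ideal.mul_mem_left _ _ h2)
  -- `(σ ϖ - ϖ dσ) σ dτ ∈ 𝔓²`
  have h4 : (σ • ϖ - ϖ * dσ) * σ • dτ ∈ 𝔓 ^ 2 := Ideal.mul_mem_right _ _ hdσ
  have e : (σ * τ) • ϖ - ϖ * (dσ * dτ) =
      σ • (τ • ϖ - ϖ * dτ) + (σ • ϖ - ϖ * dσ) * σ • dτ + ϖ * dσ * (σ • dτ - dτ) := by
    rw [mul_smul, smul_sub, smul_mul', ]
    ring
  rw [e]
  exact Submodule.add_mem _ (Submodule.add_mem _ h1 h4) h3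

/-! ### The tame character and its kernel -/

include K in
/-- **The tame character `θ₀ : G₀ → (S ⧸ 𝔓)ˣ` with kernel `G₁`** (Serre, *Local Fields*, IV §2
Prop. 7 for `i = 0`, in the global Dedekind setting): for a non-zero prime `𝔓` of
`S = integralClosure R L` (`L/K` finite Galois, `K = Frac R`, separable residue extension) there is
a group homomorphism `θ₀` from the inertia group `G₀ = I(𝔓) ≤ Gal(L/K)` to the units of the
residue ring with `θ₀ σ = 1 ↔ σ ∈ G₁` (the first ramification group): `θ₀(σ) = σ(ϖ)/ϖ mod 𝔓`
for a fixed `ϖ ∈ 𝔓 ∖ 𝔓²`; the kernel is computed by the uniformizer criterion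
(`mem_ramificationSubgroup_iff_of_mem_inertia`).
[cite: SerreLocalFields1979, Ch. IV §2 Prop. 7 and §1 Lemma 1] -/
theorem exists_tameCharacter
    [Algebra.IsSeparable (R ⧸ 𝔓.under R) (integralClosure R L ⧸ 𝔓)] (h𝔓 : 𝔓 ≠ ⊥) :
    ∃ θ : 𝔓.inertia (L ≃ₐ[K] L) →* (integralClosure R L ⧸ 𝔓)ˣ,
      ∀ σ : 𝔓.inertia (L ≃ₐ[K] L),
        θ σ = 1 ↔ (σ : L ≃ₐ[K] L) ∈ 𝔓.ramificationSubgroup (L ≃ₐ[K] L) 1 := by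
  classical
  haveI : IsDedekindDomain (integralClosure R L) := integralClosure.isDedekindDomain R K L
  letI : Field (integralClosure R L ⧸ 𝔓) := Ideal.Quotient.field 𝔓
  -- a uniformizer `ϖ ∈ 𝔓 ∖ 𝔓²`
  obtain ⟨ϖ, hϖ1, hϖ2⟩ := Ideal.exists_mem_pow_notMem_pow_succ 𝔓 h𝔓 Ideal.IsPrime.ne_top' 1
  have hϖ : ϖ ∈ 𝔓 := by rwa [pow_one] at hϖ1
  have hϖ2' : ϖ ∉ 𝔓 ^ 2 := hϖ2
  -- the coefficients `d σ`
  have hex : ∀ σ : 𝔓.inertia (L ≃ₐ[K] L), ∃ d : integralClosure R L,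
      (σ : L ≃ₐ[K] L) • ϖ - ϖ * d ∈ 𝔓 ^ 2 := fun σ ↦
    exists_smul_sub_mul_mem_sq (K := K) 𝔓 h𝔓 hϖ hϖ2' σ.2
  choose d hd using hex
  have hd0 : ∀ σ : 𝔓.inertia (L ≃ₐ[K] L), Ideal.Quotient.mk 𝔓 (d σ) ≠ 0 := fun σ h0 ↦
    not_mem_of_smul_sub_mul_mem_sq (K := K) 𝔓 h𝔓 hϖ hϖ2' σ.2 (hd σ)
      (Ideal.Quotient.eq_zero_iff_mem.mp h0)
  -- the map
  let θf : 𝔓.inertia (L ≃ₐ[K] L) → (integralClosure R L ⧸ 𝔓)ˣ := fun σ ↦ Units.mk0 _ (hd0 σ)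
  have hθf : ∀ σ, (θf σ : integralClosure R L ⧸ 𝔓) = Ideal.Quotient.mk 𝔓 (d σ) := fun σ ↦ rfl
  -- any admissible coefficient gives the same class
  have huniq : ∀ (σ : 𝔓.inertia (L ≃ₐ[K] L)) (d' : integralClosure R L),
      (σ : L ≃ₐ[K] L) • ϖ - ϖ * d' ∈ 𝔓 ^ 2 →
      Ideal.Quotient.mk 𝔓 d' = Ideal.Quotient.mk 𝔓 (d σ) := fun σ d' hd' ↦
    Ideal.Quotient.eq.mpr (sub_mem_of_smul_sub_mul_mem_sq (K := K) 𝔓 h𝔓 hϖ hϖ2' hd' (hd σ))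
  have hone : θf 1 = 1 := by
    apply Units.ext
    rw [hθf, Units.val_one, ← map_one (Ideal.Quotient.mk 𝔓)]
    refine (huniq 1 1 ?_).symm
    rw [OneMemClass.coe_one, one_smul, mul_one, sub_self]
    exact Submodule.zero_mem _
  have hmul : ∀ σ τ, θf (σ * τ) = θf σ * θf τ := by
    intro σ τ
    apply Units.ext
    rw [Units.val_mul, hθf, hθf, hθf, ← map_mul]
    refine (huniq (σ * τ) (d σ * d τ) ?_).symm
    rw [Subgroup.coe_mul]
    exact mul_smul_sub_mul_mul_mem_sq (K := K) 𝔓 hϖ σ.2 (hd σ) (hd τ)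
  refine ⟨{ toFun := θf, map_one' := hone, map_mul' := hmul }, fun σ ↦ ?_⟩
  -- kernel: `d σ ≡ 1 ↔ σ ϖ - ϖ ∈ 𝔓² ↔ σ ∈ G₁`
  rw [mem_ramificationSubgroup_iff_of_mem_inertia (K := K) 𝔓 h𝔓 σ.2 hϖ hϖ2' 1]
  change θf σ = 1 ↔ _
  rw [← Units.val_inj, hθf, Units.val_one, ← map_one (Ideal.Quotient.mk 𝔓), Ideal.Quotient.eq,
    show (1 : ℕ) + 1 = 2 from rfl]
  have e : (σ : L ≃ₐ[K] L) • ϖ - ϖ = ((σ : L ≃ₐ[K] L) • ϖ - ϖ * d σ) + ϖ * (d σ - 1) := by ring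
  rw [e]
  constructor
  · intro h
    exact Submodule.add_mem _ (hd σ) ((mul_mem_sq_iff (K := K) 𝔓 h𝔓 hϖ hϖ2' _).mpr h)
  · intro h
    have h' : ϖ * (d σ - 1) ∈ 𝔓 ^ 2 := by
      have := Submodule.sub_mem _ h (hd σ)
      rwa [add_sub_cancel_left] at this
    exact (mul_mem_sq_iff (K := K) 𝔓 h𝔓 hϖ hϖ2' _).mp h'

/-! ### Consequences: `G₁ ⊴ G₀`, `G₀/G₁` cyclic of order prime to the residue characteristic -/

omit [IsDedekindDomain R] [IsFractionRing R K] [FiniteDimensional K L] [IsGalois K L]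
  [𝔓.IsMaximal] in
/-- `G₁ ≤ G₀`. [folklore] -/
private theorem ramificationSubgroup_one_le_inertia' :
    𝔓.ramificationSubgroup (L ≃ₐ[K] L) 1 ≤ 𝔓.inertia (L ≃ₐ[K] L) :=
  Ideal.ramificationSubgroup_le_inertia 𝔓 (L ≃ₐ[K] L) 1

omit [IsDedekindDomain R] [IsFractionRing R K] [FiniteDimensional K L] [IsGalois K L]
  [𝔓.IsMaximal] in
/-- **`G₁` is normalised by `G₀`** (`Ideal.ramificationSubgroup_conj_mem`; the inertia group lies
in the decomposition group). [cite: SerreLocalFields1979, Ch. IV §1 Prop. 1] -/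
theorem conj_mem_ramificationSubgroup_one_of_mem_inertia {g n : L ≃ₐ[K] L}
    (hg : g ∈ 𝔓.inertia (L ≃ₐ[K] L)) (hn : n ∈ 𝔓.ramificationSubgroup (L ≃ₐ[K] L) 1) :
    g * n * g⁻¹ ∈ 𝔓.ramificationSubgroup (L ≃ₐ[K] L) 1 := by
  refine Ideal.ramificationSubgroup_conj_mem 𝔓 (L ≃ₐ[K] L) hn ?_
  have hg0 : g ∈ 𝔓.ramificationSubgroup (L ≃ₐ[K] L) 0 := by
    rw [Ideal.ramificationSubgroup_zero]; exact hg
  exact Ideal.ramificationSubgroup_le_decompositionSubgroup 𝔓 (L ≃ₐ[K] L) 0 hg0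

include K in
/-- **`G₀/G₁` is cyclic** (finite residue ring): some `g ∈ G₀` generates `G₀` modulo `G₁`, i.e.
every `σ ∈ G₀` is `gᵏ τ` with `k ∈ ℤ` and `τ ∈ G₁`.  The range of `θ₀` is a finite subgroup of the
unit group of the residue FIELD `S ⧸ 𝔓`, hence cyclic.
[cite: SerreLocalFields1979, Ch. IV §2 Cor. 1 of Prop. 7] -/
theorem exists_generator_inertia_mod_ramificationSubgroup_one
    [Algebra.IsSeparable (R ⧸ 𝔓.under R) (integralClosure R L ⧸ 𝔓)]
    [Finite (integralClosure R L ⧸ 𝔓)] (h𝔓 : 𝔓 ≠ ⊥) :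
    ∃ g ∈ 𝔓.inertia (L ≃ₐ[K] L), ∀ σ ∈ 𝔓.inertia (L ≃ₐ[K] L),
      ∃ (k : ℤ) (τ : L ≃ₐ[K] L), τ ∈ 𝔓.ramificationSubgroup (L ≃ₐ[K] L) 1 ∧ σ = g ^ k * τ := by
  classical
  haveI : IsDomain (integralClosure R L ⧸ 𝔓) := Ideal.Quotient.isDomain 𝔓
  haveI : IsCyclic (integralClosure R L ⧸ 𝔓)ˣ := inferInstance
  obtain ⟨θ, hθ⟩ := exists_tameCharacter (K := K) 𝔓 h𝔓
  -- the range of `θ` is cyclic, generated by some `θ g`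
  haveI hcyc : IsCyclic θ.range := Subgroup.isCyclic θ.range
  obtain ⟨γ, hγ⟩ := hcyc.exists_generator
  obtain ⟨g, hg⟩ : ∃ g : 𝔓.inertia (L ≃ₐ[K] L), θ g = (γ : (integralClosure R L ⧸ 𝔓)ˣ) :=
    γ.2
  refine ⟨g, g.2, fun σ hσ ↦ ?_⟩
  have h1 : (⟨θ ⟨σ, hσ⟩, ⟨σ, hσ⟩, rfl⟩ : θ.range) ∈ Subgroup.zpowers γ := hγ _
  obtain ⟨k, hk⟩ := Subgroup.mem_zpowers_iff.mp h1
  have hk' : (γ : (integralClosure R L ⧸ 𝔓)ˣ) ^ k = θ ⟨σ, hσ⟩ := by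
    have := congrArg Subtype.val hk
    simpa only [SubgroupClass.coe_zpow] using this
  rw [← hg, ← map_zpow] at hk'
  -- `θ ((g^k)⁻¹ σ) = 1`, so `ρ := (g^k)⁻¹ σ ∈ G₁`
  have hker : θ ((g ^ k)⁻¹ * ⟨σ, hσ⟩) = 1 := by
    rw [map_mul, map_inv, hk', inv_mul_cancel]
  set ρ : 𝔓.inertia (L ≃ₐ[K] L) := (g ^ k)⁻¹ * ⟨σ, hσ⟩ with hρ
  have hτ : (ρ : L ≃ₐ[K] L) ∈ 𝔓.ramificationSubgroup (L ≃ₐ[K] L) 1 := (hθ ρ).mp hker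
  refine ⟨k, (ρ : L ≃ₐ[K] L), hτ, ?_⟩
  have hprod : ((g : 𝔓.inertia (L ≃ₐ[K] L)) : L ≃ₐ[K] L) ^ k * (ρ : L ≃ₐ[K] L) = σ := by
    rw [hρ, Subgroup.coe_mul, Subgroup.coe_inv, SubgroupClass.coe_zpow, mul_inv_cancel_left]
  exact hprod.symm

include K in
/-- **`#G₀ = #G₁ · m` with `m ∣ #(S ⧸ 𝔓) − 1`** (finite residue ring): `m = (G₀ : G₁) = #θ₀(G₀)`
divides the order of the unit group of the residue field. In residue characteristic `p`
(`#(S ⧸ 𝔓) = p^f`) this says `m` is prime to `p`.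
[cite: SerreLocalFields1979, Ch. IV §2 Cor. 1 of Prop. 7] -/
theorem exists_card_inertia_eq_mul_dvd
    [Algebra.IsSeparable (R ⧸ 𝔓.under R) (integralClosure R L ⧸ 𝔓)]
    [Finite (integralClosure R L ⧸ 𝔓)] (h𝔓 : 𝔓 ≠ ⊥) :
    ∃ m : ℕ, Nat.card (𝔓.inertia (L ≃ₐ[K] L)) =
        Nat.card (𝔓.ramificationSubgroup (L ≃ₐ[K] L) 1) * m ∧
      m ∣ Nat.card (integralClosure R L ⧸ 𝔓) - 1 := by
  classical
  letI : Field (integralClosure R L ⧸ 𝔓) := Ideal.Quotient.field 𝔓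
  obtain ⟨θ, hθ⟩ := exists_tameCharacter (K := K) 𝔓 h𝔓
  -- `ker θ = G₁ ∩ G₀` (as a subgroup of `G₀`)
  have hker : θ.ker = (𝔓.ramificationSubgroup (L ≃ₐ[K] L) 1).subgroupOf (𝔓.inertia (L ≃ₐ[K] L)) := by
    ext σ
    rw [MonoidHom.mem_ker, hθ, Subgroup.mem_subgroupOf]
  refine ⟨Nat.card θ.range, ?_, ?_⟩
  · rw [← Subgroup.index_ker θ, hker, ← Subgroup.card_mul_index
      ((𝔓.ramificationSubgroup (L ≃ₐ[K] L) 1).subgroupOf (𝔓.inertia (L ≃ₐ[K] L)))]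
    congr 1
    exact Nat.card_congr
      (Subgroup.subgroupOfEquivOfLe (ramificationSubgroup_one_le_inertia' (K := K) 𝔓)).toEquiv
  · rw [← Nat.card_units]
    exact Subgroup.card_subgroup_dvd_card θ.range

end Literature.NumberTheory.GaloisRepresentations

end
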